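import Mathlib
import HarnessLib
import Literature.NumberTheory.LFunctions.FordLogZetaIntegralBound

/-!
# The Marsaglia–Tsang squeeze is a true squeeze on the engine's parameter range

HONEST FRAMING: exact (Metropolis-corrected) sampling algorithms for lattice gauge theory;
figures of merit are autocorrelation/cost numbers at stated couplings and volumes; no
continuum-physics claim.

Venture `LatticeQCDFlow` (cell pub-lqcd), topic `Exactness`, FANOUT row 9 (eng-latcore, the
engine `latflow.core`).  NEW WORK of the cell over Mathlib (mean-value monotonicity,
`Real.log_le_sub_one_of_pos`) and one elementary lemma of the tree's Literature library
(`FordL34.log_one_add_le_cubic`); nothing here is cited as a fact.  Printed counterpart, NAMED ONLY: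
Marsaglia–Tsang, ACM TOMS 26 (2000) 363 ("A simple method for generating gamma variables").

The CP(N−1) site heat bath of `latflow.core` draws its Beta variate from two gammas
(`BetaFromGammas.lean`), and each gamma by Marsaglia–Tsang (`csrc/cpn_kernel.c` `rng_gamma`, shape
`a ≥ 1`, `d = a − 1/3`, `c = 1/√(9d)`): propose `x ∼ N(0,1)` with `1 + cx > 0`, `v = (1+cx)³`,
`u ∼ U(0,1)`, and ACCEPT iff `u < 1 − 0.0331 x⁴` (the SQUEEZE) or `log u < x²/2 + d(1 − v + log v)`
(the TEST); output `d·v`.  The sampler is exact only if the squeeze never accepts a pair the test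
would reject, i.e. `1 − 0.0331 x⁴ ≤ exp(x²/2 + d(1 − v + log v))`.  In the reduced variable
`t = cx` (`x² = 9d t²`) the exponent is `d·φ(t)`, `φ(t) = 3 log(1+t) − 3t + (3/2)t² − t³`
(`mtPhi`, `mt_exponent_eq`), and this file proves, in exact real arithmetic:

* `taylor4_le_log_one_add` (`t ≥ 0`), `taylor_le_log_one_sub` (`0 ≤ s < 1`, remainder
  `s⁴/(4(1−s))`) — two Taylor lower bounds for the logarithm, by monotonicity from the sign of an
  explicit derivative (the cubic upper bound `log(1+t) ≤ t − t²/2 + t³/3` is REUSED from the tree: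
  `Literature.NumberTheory.LFunctions.FordL34.log_one_add_le_cubic`);
* `mtPhi_nonpos` — `φ ≤ 0` on `(−1, ∞)`: the test's acceptance probability `e^{dφ}` is `≤ 1`, the
  proposal at `x = 0` is the mode (the envelope constant is attained);
* `mtPhi_ge_of_nonneg` (`φ(t) ≥ −¾t⁴`), `mtPhi_neg_ge` (`φ(−s) ≥ −¾s⁴/(1−s)`);
* **`mt_squeeze`** — for every `d ≥ 7/6` (shape `a ≥ 3/2`: EVERY call of the engine, `a = N − 1/2`,
  `N ≥ 2`) and every `t > −1`: `1 − 0.0331·(81 d² t⁴) ≤ exp(d φ(t))`, i.e. with `x = 3√d·t`: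
  `1 − 0.0331 x⁴ ≤ e^{x²/2 + d(1 − v + log v)}`.  THE SQUEEZE IS DOMINATED BY THE TEST, so the
  accept event of one round is exactly `{log u < x²/2 + d(1 − v + log v)}`.

NOT CLAIMED: shapes `1 ≤ a < 3/2` (Marsaglia–Tsang state the squeeze for all `a ≥ 1`; numerically, at
`a = 1` the margin `dφ(t) − log(1 − 0.0331x⁴)` dips to ≈ 2·10⁻³ near `t ≈ −0.88`, far below what the
elementary bounds used here resolve — irrelevant for the engine, which never calls `a < 3/2`);
floating point.
-/

namespace Summit.Ventures.LatticeQCDFlow.Exactness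

open Set Real

/-! ## §1 Monotonicity from the sign of a derivative, anchored at `0` -/

/-- If `f` has a non-negative derivative on a convex set `D ∋ 0` then `f 0 ≤ f t` for `t ∈ D`, `t ≥ 0`. -/
theorem apply_zero_le_of_hasDerivAt_nonneg {f f' : ℝ → ℝ} {D : Set ℝ} (hD : Convex ℝ D) (h0 : (0 : ℝ) ∈ D)
    (hf : ∀ x ∈ D, HasDerivAt f (f' x) x) (hpos : ∀ x ∈ D, 0 ≤ f' x) {t : ℝ} (htD : t ∈ D) (ht : 0 ≤ t) :
    f 0 ≤ f t :=
  (monotoneOn_of_hasDerivWithinAt_nonneg hD (fun x hx => (hf x hx).continuousAt.continuousWithinAt)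
    (fun x hx => (hf x (interior_subset hx)).hasDerivWithinAt)
    (fun x hx => hpos x (interior_subset hx))) h0 htD ht

/-! ## §2 Two Taylor lower bounds for the logarithm (the cubic upper bound is the tree's `FordL34.log_one_add_le_cubic`) -/

/-- `d/dt [log(1+t) − t + t²/2 − t³/3 + t⁴/4] = t⁴/(1+t)` for `t > −1`. -/
theorem hasDerivAt_log_sub_taylor4 {s : ℝ} (hs : -1 < s) :
    HasDerivAt (fun t : ℝ => Real.log (1 + t) - t + t ^ 2 / 2 - t ^ 3 / 3 + t ^ 4 / 4) (s ^ 4 / (1 + s)) s := by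
  have h1s : (1 + s) ≠ 0 := by linarith
  have hlin : HasDerivAt (fun t : ℝ => 1 + t) 1 s := (hasDerivAt_id' s).const_add 1
  have hlog : HasDerivAt (fun t : ℝ => Real.log (1 + t)) (1 / (1 + s)) s := hlin.log h1s
  have h : HasDerivAt (fun t : ℝ => Real.log (1 + t) - t + t ^ 2 / 2 - t ^ 3 / 3 + t ^ 4 / 4)
      (1 / (1 + s) - 1 + (2 : ℕ) * s ^ (2 - 1) / 2 - (3 : ℕ) * s ^ (3 - 1) / 3 + (4 : ℕ) * s ^ (4 - 1) / 4) s :=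
    (((hlog.sub (hasDerivAt_id' s)).add ((hasDerivAt_pow 2 s).div_const 2)).sub
      ((hasDerivAt_pow 3 s).div_const 3)).add ((hasDerivAt_pow 4 s).div_const 4)
  refine h.congr_deriv ?_
  field_simp
  push_cast
  ring

/-- **`t − t²/2 + t³/3 − t⁴/4 ≤ log(1+t)`** for every `t ≥ 0`. -/
theorem taylor4_le_log_one_add {t : ℝ} (ht : 0 ≤ t) :
    t - t ^ 2 / 2 + t ^ 3 / 3 - t ^ 4 / 4 ≤ Real.log (1 + t) := by
  have h := apply_zero_le_of_hasDerivAt_nonneg (f := fun t : ℝ =>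
      Real.log (1 + t) - t + t ^ 2 / 2 - t ^ 3 / 3 + t ^ 4 / 4) (convex_Ici 0) (mem_Ici.2 le_rfl)
    (fun x hx => hasDerivAt_log_sub_taylor4 (by linarith [mem_Ici.1 hx]))
    (fun x hx => by
      have hx0 : 0 ≤ x := mem_Ici.1 hx
      positivity) (mem_Ici.2 ht) ht
  simp only [add_zero, Real.log_one] at h
  norm_num at h
  linarith

/-- `d/ds [log(1−s) + s + s²/2 + s³/3 + s⁴/(4(1−s))] = s⁴/(4(1−s)²)` for `s < 1`. -/
theorem hasDerivAt_log_one_sub_add_taylor {s : ℝ} (hs : s < 1) :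
    HasDerivAt (fun t : ℝ => Real.log (1 - t) + t + t ^ 2 / 2 + t ^ 3 / 3 + t ^ 4 / (4 * (1 - t)))
      (s ^ 4 / (4 * (1 - s) ^ 2)) s := by
  have h1s : (1 - s) ≠ 0 := by linarith
  have h4s : 4 * (1 - s) ≠ 0 := by positivity
  have hlin : HasDerivAt (fun t : ℝ => 1 - t) (-1) s := (hasDerivAt_id' s).const_sub 1
  have hlog : HasDerivAt (fun t : ℝ => Real.log (1 - t)) (-1 / (1 - s)) s := hlin.log h1s
  have hden : HasDerivAt (fun t : ℝ => 4 * (1 - t)) (4 * -1) s := hlin.const_mul 4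
  have hfrac : HasDerivAt (fun t : ℝ => t ^ 4 / (4 * (1 - t)))
      (((4 : ℕ) * s ^ (4 - 1) * (4 * (1 - s)) - s ^ 4 * (4 * -1)) / (4 * (1 - s)) ^ 2) s :=
    (hasDerivAt_pow 4 s).div hden h4s
  have h := (((hlog.add (hasDerivAt_id' s)).add ((hasDerivAt_pow 2 s).div_const 2)).add
    ((hasDerivAt_pow 3 s).div_const 3)).add hfrac
  refine h.congr_deriv ?_
  field_simp
  push_cast
  ring

/-- **`−s − s²/2 − s³/3 − s⁴/(4(1−s)) ≤ log(1−s)`** for `0 ≤ s < 1` (the tail `Σ_{k≥4} sᵏ/k` is at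
most `s⁴/(4(1−s))`). -/
theorem taylor_le_log_one_sub {s : ℝ} (hs0 : 0 ≤ s) (hs1 : s < 1) :
    -s - s ^ 2 / 2 - s ^ 3 / 3 - s ^ 4 / (4 * (1 - s)) ≤ Real.log (1 - s) := by
  have h := apply_zero_le_of_hasDerivAt_nonneg (f := fun t : ℝ =>
      Real.log (1 - t) + t + t ^ 2 / 2 + t ^ 3 / 3 + t ^ 4 / (4 * (1 - t))) (convex_Ico 0 1) ⟨le_rfl, one_pos⟩
    (fun x hx => hasDerivAt_log_one_sub_add_taylor hx.2)
    (fun x hx => by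
      have hx1 : 0 < 1 - x := by linarith [hx.2]
      positivity) ⟨hs0, hs1⟩ hs0
  simp only [sub_zero, Real.log_one] at h
  norm_num at h
  linarith

/-! ## §3 Marsaglia–Tsang's exponent and the squeeze -/

/-- **Marsaglia–Tsang's exponent in the reduced variable** `t = cx`:
`φ(t) = 3 log(1+t) − 3t + (3/2)t² − t³`. -/
noncomputable def mtPhi (t : ℝ) : ℝ := 3 * Real.log (1 + t) - 3 * t + 3 / 2 * t ^ 2 - t ^ 3

/-- **The engine's exponent is `d φ(cx)`**: with `c = 1/√(9d)`, `v = (1 + cx)³`,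
`x²/2 + d(1 − v + log v) = d φ(cx)` (`d > 0`, any real `x`). -/
theorem mt_exponent_eq {d : ℝ} (hd : 0 < d) (x : ℝ) :
    x ^ 2 / 2 + d * (1 - (1 + x / Real.sqrt (9 * d)) ^ 3 + Real.log ((1 + x / Real.sqrt (9 * d)) ^ 3)) =
      d * mtPhi (x / Real.sqrt (9 * d)) := by
  rw [Real.log_pow, mtPhi]
  have hs : Real.sqrt (9 * d) ^ 2 = 9 * d := Real.sq_sqrt (by positivity)
  have hs0 : Real.sqrt (9 * d) ≠ 0 := by positivity
  have hx : x ^ 2 = 9 * d * (x / Real.sqrt (9 * d)) ^ 2 := by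
    rw [div_pow, hs]; field_simp
  rw [hx]
  push_cast
  ring

/-- **`φ ≤ 0`** on `(−1, ∞)` (so the test's acceptance probability `e^{dφ}` is at most one). -/
theorem mtPhi_nonpos {t : ℝ} (ht : -1 < t) : mtPhi t ≤ 0 := by
  have h := Literature.NumberTheory.LFunctions.FordL34.log_one_add_le_cubic ht
  unfold mtPhi
  linarith

/-- `φ(t) ≥ −¾ t⁴` for `t ≥ 0`. -/
theorem mtPhi_ge_of_nonneg {t : ℝ} (ht : 0 ≤ t) : -(3 / 4) * t ^ 4 ≤ mtPhi t := by
  have h := taylor4_le_log_one_add ht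
  unfold mtPhi
  linarith

/-- `φ(−s) ≥ −¾ s⁴/(1−s)` for `0 ≤ s < 1`. -/
theorem mtPhi_neg_ge {s : ℝ} (hs0 : 0 ≤ s) (hs1 : s < 1) : -(3 / 4) * s ^ 4 / (1 - s) ≤ mtPhi (-s) := by
  have h := taylor_le_log_one_sub hs0 hs1
  have hφ : mtPhi (-s) = 3 * Real.log (1 - s) + 3 * s + 3 / 2 * s ^ 2 + s ^ 3 := by
    unfold mtPhi; rw [show (1 : ℝ) + -s = 1 - s by ring]; ring
  rw [hφ]
  have : -(3 / 4) * s ^ 4 / (1 - s) = 3 * (-(s ^ 4 / (4 * (1 - s)))) := by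
    field_simp
  rw [this]
  linarith

/-- The polynomial heart of the squeeze for negative `t = −s`: if `d ≥ 7/6` and the
squeeze function is positive (`0.0331·81·d²s⁴ < 1`) then `¾ ≤ 0.0331·81·d(1−s)` (any real `s`). -/
theorem mt_key {d s : ℝ} (hd : 7 / 6 ≤ d) (hS : 0.0331 * (81 * d ^ 2 * s ^ 4) < 1) :
    3 / 4 ≤ 0.0331 * 81 * d * (1 - s) := by
  have hd0 : 0 < d := by linarith
  -- `d s² < 5/8`
  have hds2 : d * s ^ 2 < 5 / 8 := by
    by_contra h
    push Not at h
    have h2 : (5 / 8) ^ 2 ≤ (d * s ^ 2) ^ 2 := pow_le_pow_left₀ (by norm_num) h 2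
    nlinarith [h2]
  -- `(ds)² < (5/8) d`
  have hds : (d * s) ^ 2 < 5 / 8 * d := by
    have : (d * s) ^ 2 = d * (d * s ^ 2) := by ring
    rw [this, mul_comm (5 / 8 : ℝ) d]
    exact mul_lt_mul_of_pos_left hds2 hd0
  by_contra h
  push Not at h
  -- then `e = d(1−s) < 7/25` and `(d − e)² = (ds)² ≥ (5/8) d`: contradiction
  have he : d * (1 - s) < 7 / 25 := by nlinarith
  have hX : 133 / 150 ≤ d * s := by nlinarith
  have hX' : 0 ≤ d * s - 133 / 150 := by linarith
  have hsum : 0 ≤ d * s + 133 / 150 - 5 / 8 := by linarith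
  nlinarith [mul_nonneg hX' hsum]

/-- **THE MARSAGLIA–TSANG SQUEEZE IS DOMINATED BY THE TEST** on the engine's range: for `d ≥ 7/6`
(shape `a = d + 1/3 ≥ 3/2`) and every `t > −1`,
`1 − 0.0331·(81 d² t⁴) ≤ exp(d φ(t))`; with `x = 3√d·t` the left side is `1 − 0.0331 x⁴` and the
right side is `exp(x²/2 + d(1 − v + log v))`, `v = (1+t)³`. -/
theorem mt_squeeze {d t : ℝ} (hd : 7 / 6 ≤ d) (ht : -1 < t) :
    1 - 0.0331 * (81 * d ^ 2 * t ^ 4) ≤ Real.exp (d * mtPhi t) := by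
  have hd0 : 0 < d := by linarith
  by_cases hS : 1 - 0.0331 * (81 * d ^ 2 * t ^ 4) ≤ 0
  · exact hS.trans (Real.exp_pos _).le
  push Not at hS
  rw [← Real.log_le_iff_le_exp hS]
  have hlog : Real.log (1 - 0.0331 * (81 * d ^ 2 * t ^ 4)) ≤ -(0.0331 * (81 * d ^ 2 * t ^ 4)) := by
    have := Real.log_le_sub_one_of_pos hS
    linarith
  refine hlog.trans ?_
  have ht4 : 0 ≤ t ^ 4 := by positivity
  rcases le_or_gt 0 t with h0 | h0
  · -- `t ≥ 0`: `dφ ≥ −¾ d t⁴ ≥ −2.6811 d² t⁴`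
    have h1 : d * (-(3 / 4) * t ^ 4) ≤ d * mtPhi t := mul_le_mul_of_nonneg_left (mtPhi_ge_of_nonneg h0) hd0.le
    nlinarith [mul_nonneg hd0.le ht4, mul_nonneg (mul_nonneg hd0.le hd0.le) ht4]
  · -- `t = −s`, `0 < s < 1`
    obtain ⟨s, rfl⟩ : ∃ s, t = -s := ⟨-t, (neg_neg t).symm⟩
    have hs0 : 0 < s := by linarith
    have hs1 : s < 1 := by linarith
    have hs4 : (-s) ^ 4 = s ^ 4 := by ring
    rw [hs4] at hS ⊢
    have h1 : d * (-(3 / 4) * s ^ 4 / (1 - s)) ≤ d * mtPhi (-s) :=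
      mul_le_mul_of_nonneg_left (mtPhi_neg_ge hs0.le hs1) hd0.le
    have hkey := mt_key (s := s) hd (by linarith [hS])
    have h2 : -(0.0331 * (81 * d ^ 2 * s ^ 4)) ≤ d * (-(3 / 4) * s ^ 4 / (1 - s)) := by
      rw [show d * (-(3 / 4) * s ^ 4 / (1 - s)) = -((3 / 4) * d * s ^ 4 / (1 - s)) by ring, neg_le_neg_iff,
        div_le_iff₀ (by linarith)]
      have hds4 : 0 ≤ d * s ^ 4 := mul_nonneg hd0.le (by positivity)
      nlinarith [mul_nonneg hds4 (sub_nonneg.2 hkey)]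
    exact h2.trans h1

end Summit.Ventures.LatticeQCDFlow.Exactness
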